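import Literature.Barriers.CriticalPhenomena.WeaklySAWCouplingFlowCutoff
import Literature.Barriers.CriticalPhenomena.WeaklySAWCouplingFlowRemainderSums
import HarnessLib

/-!
# Bridge: the (A1) cut-off hypotheses `CutoffGbarHyp` (weights `Ω^{-(j-k)₊}`) feed the weight
# structure `WeightHyp` of the perturbed flow, and `ǧ_∞ · Σ_jβ_j → 1` under them
# (Bauerschmidt–Brydges–Slade 2015, §8.3; [BBS-rg-flow], Assumption (A1))

A small joining file (theorems only). Two formalisations of Assumption (A1) of [BBS-rg-flow]
(Bauerschmidt–Brydges–Slade, AHP 16 (2015)) coexist in the tree: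

* `CTWSAW.CutoffGbarHyp β Ω k B c N g₀` (`WeaklySAWCouplingFlowCutoff.lean`): `|β_j| ≤ BΩ^{-(j-k)₊}`
  for an arbitrary cut-off `k ∈ ℕ ∪ {∞}` (the weights `cutoffWeight Ω k j = Ω^{-(j-k)₊}` of
  `WeaklySAWFlowStructuralStability.lean`), `β_j ≥ c` for `j ≤ k` off at most `N` exceptional
  scales, smallness of `g₀` — the hypotheses of Lemma 2.1 for the UNPERTURBED flow `ḡ`;
* `CTWSAW.WeightHyp β ρ g χ g₀ c R Ω jm N` (`WeaklySAWCouplingFlowRemainderSums.lean`): the same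
  exceptional-scale structure with abstract weights `χ` (`χ_{jm+1+i} ≤ Ω^{-(i+1)}`) and the
  remainder bound `ρ_l ≤ Rχ_lǧ_l` of the PERTURBED flow `ǧ_{j+1} = ǧ_j - β_jǧ_j² + r_j` of BBS 2015,
  §8.3 (`r_j = O(χ_jǧ_j³)`).

Proved here: for a finite cut-off `k`, `CutoffGbarHyp` with the remainder bound
`ρ_l ≤ RΩ^{-(l-k)₊}ǧ_l` (and `Rg₀ ≤ c/24`) yields `WeightHyp` with `χ = Ω^{-(·-k)₊}`, `jm = k`
(`CutoffGbarHyp.weightHyp`); for `β ≥ 0` it yields `GbarHyp` (`CutoffGbarHyp.gbarHyp`); hence the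
second lemma of §8.3 for the perturbed flow in the form **`ǧ_∞ · Σ_jβ_j → 1`** along families
carrying `GchHyp` and `CutoffGbarHyp` with uniform constants (`tendsto_limUnder_mul_tsum_of_cutoff`,
from `tendsto_limUnder_mul_tsum_of_weightHyp`).

## References
* R. Bauerschmidt, D. C. Brydges, G. Slade, Ann. Henri Poincaré 16 (2015), §1.3 ((1.7)–(1.8): `j_Ω`,
  `χ_j`), Assumption (A1). [BauerschmidtBrydgesSlade2015Flow]
* R. Bauerschmidt, D. C. Brydges, G. Slade, CMP 337 (2015), §6.1 (Assumption (A1)), §8.3 (second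
  lemma, `r_j = O(χ_jǧ_j³)`). [BauerschmidtBrydgesSlade2015LogCorr]
-/

noncomputable section

open Filter Topology Finset
open scoped BigOperators

namespace Literature.Barriers.CriticalPhenomena

namespace CTWSAW

namespace CutoffGbarHyp

variable {β : ℕ → ℝ} {Ω B c g₀ : ℝ} {N : ℕ}

/-- For `β ≥ 0` (the case of BBS 2015, §6.1: `β_j > 0`), the cut-off hypotheses contain the
standing hypotheses `GbarHyp` of `WeaklySAWCouplingFlow.lean` (`0 ≤ β_j ≤ B`, `g₀ > 0`, `Bg₀ ≤ 1/4`).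
[cite: BauerschmidtBrydgesSlade2015Flow, Assumption (A1)]
[cite: BauerschmidtBrydgesSlade2015LogCorr, §6.1 (β_j > 0)] -/
theorem gbarHyp {k : ℕ∞} (h : CutoffGbarHyp β Ω k B c N g₀) (hβ : ∀ j, 0 ≤ β j) :
    GbarHyp β B g₀ where
  beta_nonneg := hβ
  beta_le j := (le_abs_self (β j)).trans (h.abs_le_B j)
  pos := h.g₀_pos
  small := h.smallB

/-- **`CutoffGbarHyp` feeds `WeightHyp`** (finite cut-off `k`): with the weights
`χ_j = Ω^{-(j-k)₊}` and a remainder bound `ρ_l ≤ Rχ_lǧ_l` (`Rg₀ ≤ c/24`), the exceptional-scale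
structure of (A1) packaged in `CutoffGbarHyp β Ω k B c N g₀` is exactly the data `WeightHyp` of
`WeaklySAWCouplingFlowRemainderSums.lean` with `jm = k` (`χ_{k+1+i} = Ω^{-(i+1)}`).
[cite: BauerschmidtBrydgesSlade2015Flow, §1.3 ((1.8)) and Assumption (A1)]
[cite: BauerschmidtBrydgesSlade2015LogCorr, §8.3 (r_j = O(χ_jǧ_j³))] -/
theorem weightHyp {k : ℕ} {ρ g : ℕ → ℝ} {R : ℝ} (h : CutoffGbarHyp β Ω (k : ℕ∞) B c N g₀)
    (hR : 0 ≤ R) (hsmall : R * g₀ ≤ c / 24)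
    (hρ : ∀ l, ρ l ≤ R * cutoffWeight Ω (k : ℕ∞) l * g l) :
    WeightHyp β ρ g (cutoffWeight Ω (k : ℕ∞)) g₀ c R Ω k N where
  c_pos := h.c_pos
  R_nonneg := hR
  smallR := hsmall
  exc := by
    obtain ⟨s, hs, hβ⟩ := h.exc
    exact ⟨s, hs, fun l hl hls => hβ l (by exact_mod_cast hl) hls⟩
  chi_nonneg l := (h.weight_pos l).le
  chi_le_one l := h.weight_le_one l
  one_lt := h.one_lt
  chi_decay i := by
    rw [cutoffWeight_coe, show k + 1 + i - k = i + 1 by omega, inv_pow]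
  rho_le := hρ

end CutoffGbarHyp

/-- **`ǧ_∞ · Σ_jβ_j → 1` under the (A1) cut-off hypotheses**: along any family of perturbed flows
`ǧ(i)` (`GchHyp`) whose coefficients satisfy `CutoffGbarHyp (β i) Ω (k i) B' c N (g₀ i)` with finite
cut-offs `k i` and uniform constants, with remainder bounds `ρ_l(i) ≤ RΩ^{-(l-k(i))₊}ǧ_l(i)`,
`Rg₀(i) ≤ c/24`, in the massive case (`Σ_jβ_j(i) < ∞`) with `Σ_jβ_j(i) → ∞` and `g₀(i) → ĝ₀ > 0`:
`ǧ_∞(i) · Σ_jβ_j(i) → 1` — the second lemma of §8.3 ("`ǧ_∞ ∼ 1/𝖡_{m²}`", given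
`Σ_jβ_j = 𝖡_{m²} → ∞`) for the perturbed recursion.
[cite: BauerschmidtBrydgesSlade2015LogCorr, §8.3 (second lemma: ǧ_∞ ∼ 1/𝖡_{m²})]
[cite: BauerschmidtBrydgesSlade2015Flow, Assumption (A1), Lemma 2.1(ii)(a)] -/
theorem tendsto_limUnder_mul_tsum_of_cutoff {ι : Type*} {l : Filter ι}
    {βf ρf gf : ι → ℕ → ℝ} {k : ι → ℕ} {B B' c R Ω : ℝ} {N : ℕ} {g0 : ι → ℝ} {ĝ₀ : ℝ}
    (hh : ∀ i, GchHyp (βf i) (ρf i) (gf i) B (g0 i))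
    (hc : ∀ i, CutoffGbarHyp (βf i) Ω (k i : ℕ∞) B' c N (g0 i))
    (hR : 0 ≤ R) (hsmall : ∀ i, R * g0 i ≤ c / 24)
    (hρ : ∀ i l, ρf i l ≤ R * cutoffWeight Ω (k i : ℕ∞) l * gf i l)
    (hβ : ∀ i, Summable (βf i)) (hS : Tendsto (fun i => ∑' j, βf i j) l atTop)
    (hg : Tendsto g0 l (𝓝 ĝ₀)) (hĝ₀ : 0 < ĝ₀) :
    Tendsto (fun i => limUnder atTop (gf i) * ∑' j, βf i j) l (𝓝 1) :=
  tendsto_limUnder_mul_tsum_of_weightHyp hh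
    (fun i => (hc i).weightHyp hR (hsmall i) (hρ i)) hβ hS hg hĝ₀

end CTWSAW

end Literature.Barriers.CriticalPhenomena
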